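import Summits.AnomalousDissipation.AnomalousDissipation.Theorems.SolenoidalFractalHomogenisationLagrangianStepSidebandXEffGenDefs
import Summits.AnomalousDissipation.AnomalousDissipation.Theorems.SolenoidalFractalHomogenisationLagrangianStepSidebandSymbol
import Summits.AnomalousDissipation.AnomalousDissipation.Theorems.SolenoidalFractalHomogenisationLagrangianStepSidebandReal
import Summits.AnomalousDissipation.AnomalousDissipation.Theorems.SolenoidalFractalHomogenisationLagrangianStepSidebandLinear
import Literature.Analysis.FluidPDE.PassiveVectorTensorFourier
import HarnessLib

/-!
# K1L_D `LagrangianRenormalisationStepDesign` (stmt-AnomalousDissipation-27980), `stub_D1_V0R` (D27-1; V0 = clause (ii) of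
# `WCrossing.D1ExactFamily`), brick T7a: EXACT IDENTIFICATION — the slow modal generator of the enhancement `(1/n²)(1/ν)•psiStar` IS the period mean
# `slowMean` of the slow perturbation (helper; `--kind proof --supports stmt-AnomalousDissipation-27980 --as helper`)

Summits-side helper file of route `SolenoidalFractalHomogenisation` (prover seat `ad-k1l-cellLawV-w1` g7; 0 sorry, no defs, no named facts).  Brick T7 of the
V0 memo `Cruxes/LagrangianRenormalisationStepDesign/Lines/onelevel-V0-residual.md` §4 (the `hGx` hypothesis of `…SidebandXSlowAveraging.norm_modeRep_sub_exp_le`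
for the effective tensor of clause (V)): with `W₁ = (W.stretch M).stretch (1/ν)`, `ν > 0`, `n ≥ 1`,
`4π² P_ℓ T_{((1/n²)•((1/ν)•psiStar W M ν S))ᵀ}(ℓ) v = slowMean W₁ n ℓ (ν•S) (R0 ν) v` for EVERY `v ∈ ℂ³` — from the symbol identity
`…SidebandSymbol.symbT_majorTranspose_psiStar_apply`, the realness `…SidebandReal.im_meanFeedback_single_apply` and the `ℂ`-linearity
`…SidebandLinear.meanFeedback_map_smul` of the period-mean feedback matrices, and `(êⱼ·ℓ)/n = ξⱼ`.
* `sum_smul_single_eq` — coordinate expansion in `ℂ³`; `meanFeedback_apply_coord` — `(M v)_i = Σ_l Re((M e_l)_i)·v_l`;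
* `symbT_majorTranspose_psiStar_eq` — `T_{psiStarᵀ}(ℓ) v = (ν/4π²) Σ_{jj'} (êⱼ·ℓ)(ê_{j'}·ℓ) • M_{jj'} v`;
* **`modalAdjGen_psiStar_apply`** — the identification above; `modalAdjGen_effTensor_apply` — for `𝔹_eff = (1/n²)•(𝔸 + (1/ν)•psiStar ν S)`, `𝔸 = ν•S`:
  `4π²P_ℓT_{𝔹_effᵀ}(ℓ) v = 4π²P_ℓT_{((1/n²)•𝔸)ᵀ}(ℓ) v + slowMean W₁ n ℓ 𝔸 (R0 ν) v`.
NOT a proof of any registered stub, of K1L_D, or of anomalous dissipation; rung F-D1.A0 infrastructure.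
-/

set_option linter.dupNamespace false

noncomputable section

namespace Summit.AnomalousDissipation.AnomalousDissipation.Theorems.SolenoidalFractalHomogenisation.LagrangianStep.Sideband

open Set MeasureTheory Complex UnitAddTorus
open scoped InnerProductSpace
open Literature.Analysis Literature.Analysis.FunctionSpaces Literature.Analysis.FunctionSpaces.Torus
open Literature.Analysis.FluidPDE Literature.Analysis.FluidPDE.Torus Literature.Analysis.FluidPDE.LatticeShear

variable {k₀ : ℕ}

/-! ## §1 The period-mean feedback matrices act as REAL `ℂ`-linear matrices -/

/-- Coordinate expansion in `ℂ³`: `Σ_l v_l • e_l = v`. [folklore] -/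
theorem sum_smul_single_eq (v : EuclideanSpace ℂ (Fin 3)) : ∑ l, v l • EuclideanSpace.single l (1:ℂ) = v := by
  conv_rhs => rw [← (EuclideanSpace.basisFun (Fin 3) ℂ).sum_repr v]
  refine Finset.sum_congr rfl fun l _ => ?_
  rw [EuclideanSpace.basisFun_repr, EuclideanSpace.basisFun_apply]

/-- **`(M_{jj'} v)_i = Σ_l Re((M_{jj'} e_l)_i) · v_l`** (`ℂ`-linearity + realness of the period-mean feedback matrices). [cite: MajdaKramer1999, §2.2.1.3 (55)] -/
theorem meanFeedback_apply_coord (W₁ : LatticeWord k₀) {𝔸 : Torus.Visc4 (Fin 3)} {lo' hi' : ℝ} (h𝔸 : Torus.NearIso 𝔸 lo' hi') (hlo' : 0 < lo')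
    (R : ℕ) (j j' : Fin k₀) (v : EuclideanSpace ℂ (Fin 3)) (i : Fin 3) :
    meanFeedback W₁ 𝔸 1 R j j' v i = ∑ l, ((((meanFeedback W₁ 𝔸 1 R j j' (EuclideanSpace.single l (1:ℂ))) i).re : ℝ) : ℂ) * v l := by
  conv_lhs => rw [← sum_smul_single_eq v]
  rw [map_sum, WithLp.ofLp_sum, Finset.sum_apply]
  refine Finset.sum_congr rfl fun l _ => ?_
  rw [meanFeedback_map_smul W₁ h𝔸 hlo' one_pos R j j' (v l) (EuclideanSpace.single l (1:ℂ)), WithLp.ofLp_smul, Pi.smul_apply,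
    smul_eq_mul, mul_comm]
  congr 1
  have him := im_meanFeedback_single_apply W₁ h𝔸 hlo' one_pos R j j' l i
  apply Complex.ext
  · simp
  · simp [him]

/-! ## §2 The symbol of `psiStar` as an operator identity -/

/-- **`T_{psiStarᵀ}(ℓ) v = (ν/(4π²)) Σ_{jj'} (êⱼ·ℓ)(ê_{j'}·ℓ) • M_{jj'} v`** (`ν > 0`, `W₁ = (W.stretch M).stretch (1/ν)`, `M_{jj'} = meanFeedback W₁ (ν•S) 1 (R0 ν) j j'`).
[cite: MajdaKramer1999, §2.2.1.3 (55)] [cite: Frisch1995Turbulence, §9.6.3 eq. (9.57) p. 233] -/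
theorem symbT_majorTranspose_psiStar_eq (W : LatticeWord k₀) (M : ℝ) (hM : 0 < M) {ν : ℝ} (hν : 0 < ν) {S : Torus.Visc4 (Fin 3)}
    {lo' hi' : ℝ} (hS : Torus.NearIso (ν • S) lo' hi') (hlo' : 0 < lo') (ℓ : Fin 3 → ℤ) (v : EuclideanSpace ℂ (Fin 3)) :
    Torus.symbT (Torus.majorTranspose (psiStar W M hM ν S)) ℓ v =
      ((ν / (4 * Real.pi ^ 2) : ℝ) : ℂ) • ∑ j, ∑ j',
        (((∑ a, (((W.stretch M hM).stretch (1 / ν) (one_div_pos.mpr hν)).phase j).e a * (ℓ a : ℝ) : ℝ) : ℂ) *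
         ((∑ b, (((W.stretch M hM).stretch (1 / ν) (one_div_pos.mpr hν)).phase j').e b * (ℓ b : ℝ) : ℝ) : ℂ)) •
        meanFeedback ((W.stretch M hM).stretch (1 / ν) (one_div_pos.mpr hν)) (ν • S) 1 (R0 ν) j j' v := by
  set W₁ := (W.stretch M hM).stretch (1 / ν) (one_div_pos.mpr hν) with hW₁
  -- opaque abbreviations
  obtain ⟨A, hA⟩ : ∃ A : Fin k₀ → ℂ, ∀ j, ((∑ a, (W₁.phase j).e a * (ℓ a : ℝ) : ℝ) : ℂ) = A j := ⟨_, fun _ => rfl⟩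
  obtain ⟨m, hm⟩ : ∃ m : Fin k₀ → Fin k₀ → Fin 3 → Fin 3 → ℂ, ∀ j j' l i,
      ((((meanFeedback W₁ (ν • S) 1 (R0 ν) j j' (EuclideanSpace.single l (1:ℂ))) i).re : ℝ) : ℂ) = m j j' l i := ⟨_, fun _ _ _ _ => rfl⟩
  obtain ⟨c, hc⟩ : ∃ c : ℂ, ((ν / (4 * Real.pi ^ 2) : ℝ) : ℂ) = c := ⟨_, rfl⟩
  ext i
  rw [symbT_majorTranspose_psiStar_apply W M hM hν S ℓ v i]
  simp only [WithLp.ofLp_smul, Pi.smul_apply, WithLp.ofLp_sum, Finset.sum_apply, smul_eq_mul]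
  simp only [← hW₁, hA, hm, hc, meanFeedback_apply_coord W₁ hS hlo' (R0 ν) _ _ v i]
  -- Σ_l (c Σⱼⱼ' Aⱼ Aⱼ' m) v_l = c Σⱼⱼ' Aⱼ Aⱼ' Σ_l m v_l
  simp only [Finset.mul_sum, Finset.sum_mul]
  rw [Finset.sum_comm]
  refine Finset.sum_congr rfl fun j _ => ?_
  rw [Finset.sum_comm]
  refine Finset.sum_congr rfl fun j' _ => Finset.sum_congr rfl fun l _ => ?_
  ring

/-! ## §3 The identification -/

/-- **THE SLOW MODAL GENERATOR OF THE ENHANCEMENT IS THE PERIOD MEAN OF THE SLOW PERTURBATION** (`ν > 0`, `n ≥ 1`, `W₁ = (W.stretch M).stretch (1/ν)`):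
`4π² P_ℓ T_{((1/n²)•((1/ν)•psiStar W M ν S))ᵀ}(ℓ) v = slowMean W₁ n ℓ (ν•S) (R0 ν) v` for every `v ∈ ℂ³`.
[cite: MajdaKramer1999, §2.2.1.3 (55) (effective diffusivity as a cell average)] [cite: ArmstrongVicol2025, §3 (renormalised diffusivity of one level)] -/
theorem modalAdjGen_psiStar_apply (W : LatticeWord k₀) (M : ℝ) (hM : 0 < M) {ν : ℝ} (hν : 0 < ν) {S : Torus.Visc4 (Fin 3)}
    {lo' hi' : ℝ} (hS : Torus.NearIso (ν • S) lo' hi') (hlo' : 0 < lo') {n : ℕ} (hn : n ≠ 0) (ℓ : Fin 3 → ℤ) (v : EuclideanSpace ℂ (Fin 3)) :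
    Torus.modalAdjGen (Torus.majorTranspose ((1 / (n : ℝ) ^ 2) • ((1 / ν) • psiStar W M hM ν S))) ℓ v =
      slowMean ((W.stretch M hM).stretch (1 / ν) (one_div_pos.mpr hν)) n ℓ (ν • S) (R0 ν) v := by
  set W₁ := (W.stretch M hM).stretch (1 / ν) (one_div_pos.mpr hν) with hW₁
  have hn0 : (n : ℝ) ≠ 0 := by exact_mod_cast hn
  have hπ : (4 * Real.pi ^ 2 : ℝ) ≠ 0 := by positivity
  rw [Torus.majorTranspose_smul, Torus.majorTranspose_smul, Torus.modalAdjGen_apply, Torus.symbT_smul_tensor, Torus.symbT_smul_tensor,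
    symbT_majorTranspose_psiStar_eq W M hM hν hS hlo' ℓ v, ← hW₁, slowMean_apply]
  simp only [smul_smul, map_smul, map_sum, Finset.smul_sum]
  refine Finset.sum_congr rfl fun j _ => Finset.sum_congr rfl fun j' _ => ?_
  rw [← Complex.coe_smul, xiCoeff_def, xiCoeff_def]
  congr 1
  have hνC : (ν : ℂ) ≠ 0 := by exact_mod_cast hν.ne'
  push_cast
  field_simp

/-- **The modal generator of the effective cell tensor of clause (V)**: for `𝔸 = ν • S` (`ν > 0`, `n ≥ 1`),
`4π²P_ℓT_{((1/n²)•(𝔸 + (1/ν)•psiStar W M ν S))ᵀ}(ℓ) v = 4π²P_ℓT_{((1/n²)•𝔸)ᵀ}(ℓ) v + slowMean W₁ n ℓ 𝔸 (R0 ν) v`.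
[cite: MajdaKramer1999, §2.2.1.3 (55)] -/
theorem modalAdjGen_effTensor_apply (W : LatticeWord k₀) (M : ℝ) (hM : 0 < M) {ν : ℝ} (hν : 0 < ν) {S : Torus.Visc4 (Fin 3)}
    {lo' hi' : ℝ} (hS : Torus.NearIso (ν • S) lo' hi') (hlo' : 0 < lo') {n : ℕ} (hn : n ≠ 0) (ℓ : Fin 3 → ℤ) (v : EuclideanSpace ℂ (Fin 3)) :
    Torus.modalAdjGen (Torus.majorTranspose ((1 / (n : ℝ) ^ 2) • (ν • S + (1 / ν) • psiStar W M hM ν S))) ℓ v =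
      Torus.modalAdjGen (Torus.majorTranspose ((1 / (n : ℝ) ^ 2) • (ν • S))) ℓ v +
        slowMean ((W.stretch M hM).stretch (1 / ν) (one_div_pos.mpr hν)) n ℓ (ν • S) (R0 ν) v := by
  rw [smul_add, Torus.majorTranspose_add, Torus.modalAdjGen_apply, Torus.symbT_add_tensor, map_add, smul_add, ← Torus.modalAdjGen_apply,
    ← Torus.modalAdjGen_apply, modalAdjGen_psiStar_apply W M hM hν hS hlo' hn ℓ v]

end Summit.AnomalousDissipation.AnomalousDissipation.Theorems.SolenoidalFractalHomogenisation.LagrangianStep.Sideband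

end
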